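import Summits.SmoothPoincare4.SmoothPoincare4.Theorems.WeakReductionDescentWeakReductionReducesStubLoopDichotomyFromFiveCoreAux0
import HarnessLib

/-!
# Crux `WeakReductionReduces` (stmt-SmoothPoincare4-17908), line `loop_dichotomy`, stub CORE₅
# (`stub_loopDichotomyFromFiveCore`) — wave 2, structural lemma (H1), part 2 of 2:
# a non-separating curve compressing in `H₁` and in `H₂` forces `1 ≤ k 0`

Registered helper `helper_one_le_kZero_of_doublyCompressing` (stub-add on the crux; lands
`--supports stmt-SmoothPoincare4-17908`).  **Everything here is proved; no definition and no named
fact is introduced.**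

**Theorem.**  Let `S` be a Gay–Kirby `(g; k)`-trisection of a smooth `4`-manifold `X`
(`IsGKTrisection X g k S`; no homotopy-sphere hypothesis), `F = ⋂ l, S l` its central surface and
`H_q = Trisection.spineHandlebody S q = S (q+1) ∩ S (q+2)` the handlebodies of the spine.  If a curve
`c′ ⊆ F` (`Trisection.IsCurve`) is non-separating in `F` (`Trisection.IsNonSeparating`) and bounds
a compressing disc both in `H₁` and in `H₂` (`Trisection.BoundsDisc`), then `1 ≤ k 0`.

*Mathematics.*  `H₁ ∪_F H₂ = ∂X₀` is the genus-`g` Heegaard splitting of the boundary of the sector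
`X₀ = S 0`, so `c′` is a non-separating reducing curve of `∂X₀ ≅ #^{k 0}(S¹ × S²)`, and a
non-separating reducing sphere forces `k 0 ≥ 1` (Aranda–Zupan, §2 p. 6, the remark used on p. 21).
The proof is the `π₁`-shadow of this: the winding character of `c′` on `π₁(F)` kills
`K₁`, `K₂`, so it lives on `π₁(F) ⧸ ⟪K₁ ∪ K₂⟫ ≅ π₁(∂X₀) ≅ F_{k 0}` ((T2) + (T3)), and it is
non-trivial on a loop of `F` crossing `c′` once — the assembly
`one_le_kZero_of_sideFunctions_two` of part 1 (`…StubLoopDichotomyFromFiveCoreAux0.lean`).  This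
part supplies its hypotheses from the two discs, verbatim as the tree's three-disc theorem
`Trisection.not_simplyConnectedSpace_of_reducing_nonseparating`
(`ReducibleTrisectionNotSimplyConnected.lean`), the disc in `H₁` playing the reference role of
`D_0` there: global side functions of the discs (`IsGKTrisection.exists_sideFunction_of_disc`),
their compatibility on `F` near `c′` (`IsLocalSide.exists_mul_eq`, `exists_open_forall_eq_of_local`)
and the crossing arc of `exists_isLocalSide_of_disc`, rescaled.

## References

* R. Aranda, A. Zupan, *Manifolds with weakly reducible genus-three trisections are standard*,
  arXiv:2503.04607 (2025), §2 (p. 6), p. 21. [ArandaZupan2025]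
* A. Abrams, D. Gay, R. Kirby, *Group trisections and smooth 4-manifolds*, Geom. Topol. 22
  (2018), p. 1540 (the map `𝒢`). [AbramsGayKirby2018]
* A. Hatcher, *Algebraic Topology*, CUP (2002), Prop. 1.26. [HatcherAT2002]
* M. W. Hirsch, *Differential Topology*, GTM 33 (1976), Ch. 4, Thm. 4.6. [HirschDT1976]
-/

-- the registered namespace `Summit.SmoothPoincare4.SmoothPoincare4.Theorems…` repeats a component
set_option linter.dupNamespace false

noncomputable section

open Set Function Filter Topology Metric
open scoped Manifold ContDiff unitInterval
open Literature.Topology.FourManifolds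
open Literature.AlgebraicTopology Literature.AlgebraicTopology.FundamentalGroup
  Literature.AlgebraicTopology.FundamentalGroup.VanKampen

namespace Summit.SmoothPoincare4.SmoothPoincare4.Theorems.WeakReductionReduces.LoopDichotomy

universe u

variable {X : Type u} [TopologicalSpace X] [T2Space X] [SecondCountableTopology X]
  [ChartedSpace (EuclideanSpace ℝ (Fin 4)) X] {g : ℕ} {k : Fin 3 → ℕ} {S : Fin 3 → Set X}

/-! ### Side functions of the two discs, and the theorem -/

/-- **A non-separating curve on the central surface which bounds compressing discs in `H₁` and
in `H₂` forces `1 ≤ k 0`.**  Let `S` be a Gay–Kirby trisection of the smooth `4`-manifold `X`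
(`IsGKTrisection X g k S`) and `δ` a curve on the central surface `F` which is non-separating in
`F` and bounds a compressing disc in `H_{q+1} = Trisection.spineHandlebody S q.succ` for `q = 0, 1`.
Then `1 ≤ k 0`.  For each disc `D_q = d_q(𝔻²)` the tree supplies a global side function near
`D_q` in `H_{q+1}` together with local side indicators and crossing arcs along `δ`
(`IsGKTrisection.exists_sideFunction_of_disc`); at a point of `δ` the indicators of `D_1` and
`D_0` are both local side indicators of `δ` in `F`, so `sd_1 · sd_0` is locally constant on
`F ∖ δ` near `δ` (`IsLocalSide.exists_mul_eq`), hence constant near the connected `δ`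
(`exists_open_forall_eq_of_local`); the crossing arc of `D_0` rescaled into that neighbourhood
completes the hypotheses of `one_le_kZero_of_sideFunctions_two`.  The proof is that of
`Trisection.not_simplyConnectedSpace_of_reducing_nonseparating` with two discs.
[cite: ArandaZupan2025, §2 (p. 6)] [cite: HatcherAT2002, Prop. 1.26] -/
theorem one_le_kZero_of_doublyCompressing_nonseparating
    [IsManifold (𝓡 4) ∞ X] (h : IsGKTrisection X g k S) {δ : Set X} (hc : Trisection.IsCurve S δ)
    (hdisc : ∀ q : Fin 2, Trisection.BoundsDisc S (Trisection.spineHandlebody S q.succ) δ)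
    (hns : Trisection.IsNonSeparating S δ) : 1 ≤ k 0 := by
  classical
  set F := ⋂ l, S l with hF
  have hδF : δ ⊆ F := hc.1
  have hFH : ∀ q : Fin 2, F ⊆ Trisection.spineHandlebody S q.succ := fun q =>
    Trisection.centralSurfaceSet_subset_spineHandlebody S q.succ
  -- the two discs and their side functions
  choose d hd hdH hdδ hdF0 using hdisc
  have hdF : ∀ q, range (d q) ∩ F = δ := hdF0
  have hdata := fun q => h.exists_sideFunction_of_disc q.succ (hd q) (hdH q) (hdδ q) (hdF q)
  choose O sd W s hO hDO hsd hzW hκ hbd using hdata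
  -- elementary facts about the discs
  have hδD : ∀ q, δ ⊆ range (d q) := fun q y hy => by
    have : y ∈ range (d q) ∩ F := by rw [hdF q]; exact hy
    exact this.1
  haveI := compactSpace_closedBall_two
  have hDc : ∀ q, IsClosed (range (d q)) := fun q =>
    (isCompact_range (hd q).contMDiff.continuous).isClosed
  -- preimages on the disc of the points of `δ`
  have hzδ : ∀ q, ∀ p ∈ δ, ∃ z, d q z = p ∧ d q z ∈ F := fun q p hp => by
    obtain ⟨z, hz⟩ := hδD q hp
    exact ⟨z, hz, hz.symm ▸ hδF hp⟩
  /- Step 1: `sd q * sd 0` is locally constant on `F ∖ δ` near every point of `δ`. -/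
  have hprod : ∀ q, ∀ p ∈ δ, ∃ c : ℝ, (c = 1 ∨ c = -1) ∧
      ∀ᶠ y in 𝓝 p, y ∈ F \ δ → sd q y * sd 0 y = c := by
    intro q p hp
    obtain ⟨zq, hzq, hzqF⟩ := hzδ q p hp
    obtain ⟨z0, hz0, hz0F⟩ := hzδ 0 p hp
    have hLq : IsLocalSide F δ (W q zq) (s q zq) := (hbd q zq hzqF).1
    have hL0 : IsLocalSide F δ (W 0 z0) (s 0 z0) := (hbd 0 z0 hz0F).1
    obtain ⟨m, hm1, hm⟩ := hLq.exists_mul_eq hL0 hp (hzq ▸ hzW q zq) (hz0 ▸ hzW 0 z0)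
    obtain ⟨κq, hκq1, hκq⟩ := hκ q zq p ⟨hδD q hp, hzq ▸ hzW q zq⟩
    obtain ⟨κ0, hκ01, hκ0⟩ := hκ 0 z0 p ⟨hδD 0 hp, hz0 ▸ hzW 0 z0⟩
    refine ⟨κq * κ0 * m, ?_, ?_⟩
    · rcases hκq1 with rfl | rfl <;> rcases hκ01 with rfl | rfl <;> rcases hm1 with rfl | rfl <;>
        norm_num
    · filter_upwards [hm, hκq, hκ0] with y hmy hqy h0y hy
      have hyq : y ∈ Trisection.spineHandlebody S q.succ \ range (d q) :=
        ⟨hFH q hy.1, fun hyd => hy.2 (by rw [← hdF q]; exact ⟨hyd, hy.1⟩)⟩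
      have hy0 : y ∈ Trisection.spineHandlebody S (0 : Fin 2).succ \ range (d 0) :=
        ⟨hFH 0 hy.1, fun hyd => hy.2 (by rw [← hdF 0]; exact ⟨hyd, hy.1⟩)⟩
      rw [hqy hyq, h0y hy0, ← hmy hy]
      ring
  /- Step 2: an open `A ⊇ δ` on which the products are constant (in the subspace `F`). -/
  set δF : Set ↥F := Subtype.val ⁻¹' δ with hδFdef
  have himage : Subtype.val '' δF = δ := by
    ext y
    simp only [hδFdef, mem_image, mem_preimage]
    exact ⟨fun ⟨z, hz, hzy⟩ => hzy ▸ hz, fun hy => ⟨⟨y, hδF hy⟩, hy, rfl⟩⟩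
  have hδFconn : IsPreconnected δF := by
    rw [← Topology.IsInducing.subtypeVal.isPreconnected_image, himage]
    exact hc.isConnected.isPreconnected
  -- `δ` is nowhere dense in `F`: the `F`-sides accumulate at its points
  have hnd : ∀ p ∈ δF, ∀ V ∈ 𝓝 p, (V \ δF).Nonempty := by
    intro p hp V hV
    obtain ⟨U, hU, hUV⟩ : ∃ U ∈ 𝓝 (p : X), Subtype.val ⁻¹' U ⊆ V := by
      rw [nhds_subtype] at hV
      exact Filter.mem_comap.1 hV
    obtain ⟨z0, hz0, hz0F⟩ := hzδ 0 p hp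
    have hL0 : IsLocalSide F δ (W 0 z0) (s 0 z0) := (hbd 0 z0 hz0F).1
    have hcl := hL0.mem_closure p ⟨hp, hz0 ▸ hzW 0 z0⟩ 1 (Or.inl rfl)
    obtain ⟨y, hyU, hy⟩ := mem_closure_iff_nhds.1 hcl U hU
    exact ⟨⟨y, hy.1.1.2⟩, hUV hyU, hy.1.2⟩
  have hAq : ∀ q, ∃ U : Set X, IsOpen U ∧ δ ⊆ U ∧ ∃ c : ℝ,
      ∀ y ∈ (U ∩ F) \ δ, sd q y * sd 0 y = c := by
    intro q
    have hloc' : ∀ p ∈ δF, ∃ W' ∈ 𝓝 p, ∃ c : ℝ, ∀ y ∈ W' \ δF,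
        sd q (y : X) * sd 0 (y : X) = c := by
      intro p hp
      obtain ⟨c, -, hc'⟩ := hprod q p hp
      obtain ⟨U, hUc, hUo, hpU⟩ := eventually_nhds_iff.1 hc'
      refine ⟨Subtype.val ⁻¹' U, (hUo.preimage continuous_subtype_val).mem_nhds hpU, c,
        fun y hy => hUc y hy.1 ⟨y.2, hy.2⟩⟩
    obtain ⟨A', hA'o, hδA', c, hc'⟩ :=
      exists_open_forall_eq_of_local hδFconn hnd hloc'
    obtain ⟨U, hUo, hUA'⟩ := isOpen_induced_iff.1 hA'o
    refine ⟨U, hUo, fun y hy => ?_, c, fun y hy => ?_⟩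
    · have : (⟨y, hδF hy⟩ : ↥F) ∈ A' := hδA' hy
      rw [← hUA'] at this
      exact this
    · have hyA' : (⟨y, hy.1.2⟩ : ↥F) ∈ A' := by rw [← hUA']; exact hy.1.1
      exact hc' ⟨y, hy.1.2⟩ ⟨hyA', hy.2⟩
  choose U hUo hδU c hcU using hAq
  set A : Set X := (⋂ q, U q) ∩ ⋂ q, O q with hA_def
  have hA : IsOpen A :=
    (isOpen_iInter_of_finite hUo).inter (isOpen_iInter_of_finite hO)
  have hδA : δ ⊆ A := fun y hy =>
    ⟨mem_iInter.2 fun q => hδU q hy, mem_iInter.2 fun q => hDO q (hδD q hy)⟩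
  have hAO : ∀ q, A ⊆ O q := fun q y hy => (mem_iInter.1 hy.2) q
  have hAU : ∀ q, A ⊆ U q := fun q y hy => (mem_iInter.1 hy.1) q
  have hsd1 : ∀ q, ∀ y ∈ (A ∩ F) \ δ, sd q y = 1 ∨ sd q y = -1 := fun q y hy =>
    (hsd q y ⟨⟨hAO q hy.1.1, hFH q hy.1.2⟩,
      fun hyd => hy.2 (by rw [← hdF q]; exact ⟨hyd, hy.1.2⟩)⟩).1
  have hcomp : ∀ q, (∀ y ∈ (A ∩ F) \ δ, sd q y = sd 0 y) ∨
      (∀ y ∈ (A ∩ F) \ δ, sd q y = -sd 0 y) := by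
    intro q
    by_cases hex : ∃ y, y ∈ (A ∩ F) \ δ
    · obtain ⟨y₀, hy₀⟩ := hex
      have hc0 : c q = sd q y₀ * sd 0 y₀ := (hcU q y₀ ⟨⟨hAU q hy₀.1.1, hy₀.1.2⟩, hy₀.2⟩).symm
      have key : ∀ y ∈ (A ∩ F) \ δ, sd q y = c q * sd 0 y := by
        intro y hy
        have h1 := hcU q y ⟨⟨hAU q hy.1.1, hy.1.2⟩, hy.2⟩
        have h2 : sd 0 y * sd 0 y = 1 := by
          rcases hsd1 0 y hy with h | h <;> rw [h] <;> norm_num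
        calc sd q y = sd q y * (sd 0 y * sd 0 y) := by rw [h2, mul_one]
          _ = c q * sd 0 y := by rw [← mul_assoc, h1]
      have hc1 : c q = 1 ∨ c q = -1 := by
        rw [hc0]
        rcases hsd1 q y₀ hy₀ with h | h <;> rcases hsd1 0 y₀ hy₀ with h' | h' <;>
          rw [h, h'] <;> norm_num
      rcases hc1 with h1 | h1
      · exact Or.inl fun y hy => by rw [key y hy, h1, one_mul]
      · exact Or.inr fun y hy => by rw [key y hy, h1, neg_one_mul]
    · exact Or.inl fun y hy => (hex ⟨y, hy⟩).elim
  /- Step 3: the crossing arc of the disc `D_0`, rescaled into `A`. -/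
  obtain ⟨p₀, hp₀⟩ := hc.nonempty
  obtain ⟨z0, hz0, hz0F⟩ := hzδ 0 p₀ hp₀
  obtain ⟨-, γ, τ, hτ, hγc, hγ0, hγ⟩ := hbd 0 z0 hz0F
  obtain ⟨κ, hκ1, hκev⟩ := hκ 0 z0 p₀ ⟨hδD 0 hp₀, hz0 ▸ hzW 0 z0⟩
  -- a small parameter interval on which `γ` stays in `A` and in the comparison neighbourhood
  obtain ⟨Uκ, hUκ, hUκo, hpUκ⟩ := eventually_nhds_iff.1 hκev
  have hγca : ContinuousAt γ 0 :=
    hγc.continuousAt (Icc_mem_nhds (by linarith) hτ)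
  obtain ⟨τ', hτ', hτ'τ, hγin⟩ : ∃ τ' > 0, τ' ≤ τ ∧ ∀ t ∈ Icc (-τ') τ', γ t ∈ A ∩ Uκ := by
    have hmem : γ ⁻¹' (A ∩ Uκ) ∈ 𝓝 (0 : ℝ) := by
      refine hγca.preimage_mem_nhds ((hA.inter hUκo).mem_nhds ?_)
      rw [hγ0, hz0]
      exact ⟨hδA hp₀, hpUκ⟩
    obtain ⟨ε, hε, hball⟩ := Metric.mem_nhds_iff.1 hmem
    refine ⟨min (ε / 2) τ, lt_min (by linarith) hτ, min_le_right _ _, fun t ht => hball ?_⟩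
    rw [Real.ball_eq_Ioo, zero_sub, zero_add]
    exact ⟨by linarith [ht.1, min_le_left (ε / 2) τ], by linarith [ht.2, min_le_left (ε / 2) τ]⟩
  have hIcc : ∀ t ∈ Icc (-τ') τ', t ∈ Icc (-τ) τ := fun t ht =>
    ⟨by linarith [ht.1], by linarith [ht.2]⟩
  -- the rescaled arc `r ↦ γ (ε (2r - 1) τ')` with `ε = -κ`
  set lam : I → ℝ := fun r => -κ * ((2 * (r : ℝ) - 1) * τ') with hlam
  have hlam_mem : ∀ r : I, lam r ∈ Icc (-τ') τ' := by
    intro r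
    have h0 := r.2.1
    have h1 := r.2.2
    have hb : |(2 * (r : ℝ) - 1) * τ'| ≤ τ' := by
      rw [abs_mul, abs_of_pos hτ']
      have : |2 * (r : ℝ) - 1| ≤ 1 := abs_le.2 ⟨by linarith, by linarith⟩
      nlinarith
    rcases hκ1 with rfl | rfl
    · simp only [hlam, neg_mul, one_mul]
      have := abs_le.1 hb
      exact ⟨by linarith [this.2], by linarith [this.1]⟩
    · simp only [hlam, neg_neg, one_mul]
      exact abs_le.1 hb
  have hlamc : Continuous lam := by
    simp only [hlam]
    fun_prop
  have hαc : Continuous fun r : I => (⟨γ (lam r), (hγ _ (hIcc _ (hlam_mem r))).1.1⟩ : ↥F) :=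
    (hγc.comp_continuous (hlamc) fun r => hIcc _ (hlam_mem r)).subtype_mk _
  set αf : C(I, ↥F) := ⟨fun r => ⟨γ (lam r), (hγ _ (hIcc _ (hlam_mem r))).1.1⟩, hαc⟩ with hαf
  let α : Path (αf 0) (αf 1) := ⟨αf, rfl, rfl⟩
  have hαapply : ∀ r : I, (α r : X) = γ (lam r) := fun r => rfl
  set s₀ : I := ⟨1 / 2, by norm_num, by norm_num⟩ with hs₀
  have hlam₀ : lam s₀ = 0 := by simp [hlam, hs₀]
  have hlam_sign : ∀ r : I, r ≠ s₀ → lam r ≠ 0 ∧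
      (r < s₀ → Real.sign (lam r) = κ) ∧ (s₀ < r → Real.sign (lam r) = -κ) := by
    intro r hr
    have hne : (r : ℝ) ≠ 1 / 2 := fun h' => hr (Subtype.ext (by rw [h']))
    have hlt_iff : r < s₀ ↔ (r : ℝ) < 1 / 2 := Iff.rfl
    have hgt_iff : s₀ < r ↔ (1 : ℝ) / 2 < r := Iff.rfl
    refine ⟨?_, fun hlt => ?_, fun hgt => ?_⟩
    · simp only [hlam]
      rcases hκ1 with rfl | rfl <;>
        · intro h0
          have : (2 * (r : ℝ) - 1) * τ' = 0 := by linarith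
          rcases mul_eq_zero.1 this with h' | h'
          · exact hne (by linarith)
          · exact hτ'.ne' h'
    · rw [hlt_iff] at hlt
      have hneg : (2 * (r : ℝ) - 1) * τ' < 0 := by nlinarith
      rcases hκ1 with rfl | rfl
      · simp only [hlam, neg_mul, one_mul]
        exact Real.sign_of_pos (by linarith)
      · simp only [hlam, neg_neg, one_mul]
        exact Real.sign_of_neg hneg
    · rw [hgt_iff] at hgt
      have hpos : 0 < (2 * (r : ℝ) - 1) * τ' := by nlinarith
      rcases hκ1 with rfl | rfl
      · simp only [hlam, neg_mul, one_mul]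
        exact Real.sign_of_neg (by linarith)
      · simp only [hlam, neg_neg, one_mul]
        exact Real.sign_of_pos hpos
  have hκsq : κ * κ = 1 := by rcases hκ1 with rfl | rfl <;> norm_num
  have hside : ∀ r : I, r ≠ s₀ → (α r : X) ∉ δ ∧ sd 0 (α r) = κ * -Real.sign (lam r) := by
    intro r hr
    have hmem := hlam_mem r
    obtain ⟨⟨hγF, hγW⟩, hγt⟩ := hγ _ (hIcc _ hmem)
    obtain ⟨hγd, hγs⟩ := hγt (hlam_sign r hr).1
    rw [hαapply]
    refine ⟨fun hδ => hγd (hδD 0 hδ), ?_⟩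
    rw [← hγs]
    exact hUκ _ (hγin _ hmem).2 ⟨hFH 0 hγF, hγd⟩
  refine one_le_kZero_of_sideFunctions_two h hc hns (fun q => range (d q)) hDc hdH hdF
    O hO hDO sd hsd A hA hδA hAO hcomp α (fun r => (hγin _ (hlam_mem r)).1) s₀
    ⟨by norm_num [hs₀], by norm_num [hs₀]⟩ ?_ (fun r hr => ?_) (fun r hr => ?_)
  · rw [hαapply, hlam₀, hγ0, hz0]; exact hp₀
  · obtain ⟨hnot, hval⟩ := hside r hr.ne
    refine ⟨hnot, ?_⟩
    rw [hval, (hlam_sign r hr.ne).2.1 hr]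
    linarith [hκsq]
  · obtain ⟨hnot, hval⟩ := hside r hr.ne'
    refine ⟨hnot, ?_⟩
    rw [hval, (hlam_sign r hr.ne').2.2 hr]
    linarith [hκsq]

/-! ### The registered helper -/

/-- **(H1) `helper_one_le_kZero_of_doublyCompressing`.**  For ANY Gay–Kirby `(g; k)`-trisection
`S` of a smooth `4`-manifold `X`: if a non-separating curve `c′` on the central surface bounds
compressing discs both in `H₁ = Trisection.spineHandlebody S 1` and in
`H₂ = Trisection.spineHandlebody S 2`, then `1 ≤ k 0` — `c′` is a non-separating reducing curve of
the Heegaard splitting `H₁ ∪_F H₂ = ∂X₀ ≅ #^{k 0}(S¹ × S²)`, whose `π₁ ≅ F_{k 0}` then carries the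
non-trivial winding character of `c′` (`one_le_kZero_of_doublyCompressing_nonseparating`).  This
disposes of the sub-family `k 0 = 0` of the fixed-label core CORE₅ of the line `loop_dichotomy`
(and, at genus `4`, of the type `(0; 2, 2)`).
[cite: ArandaZupan2025, §2 (p. 6)] [cite: AbramsGayKirby2018, p. 1540 (the map 𝒢)] -/
theorem helper_one_le_kZero_of_doublyCompressing : ∀ (X : Type) [TopologicalSpace X] [T2Space X]
    [SecondCountableTopology X] [ChartedSpace (EuclideanSpace ℝ (Fin 4)) X]
    [IsManifold (𝓡 4) ((⊤ : ℕ∞) : WithTop ℕ∞) X] (g : ℕ) (k : Fin 3 → ℕ) (S : Fin 3 → Set X),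
    Literature.Topology.FourManifolds.IsGKTrisection X g k S → ∀ (c' : Set X),
    Literature.Topology.FourManifolds.Trisection.IsCurve S c' →
    Literature.Topology.FourManifolds.Trisection.IsNonSeparating S c' →
    Literature.Topology.FourManifolds.Trisection.BoundsDisc S
      (Literature.Topology.FourManifolds.Trisection.spineHandlebody S 1) c' →
    Literature.Topology.FourManifolds.Trisection.BoundsDisc S
      (Literature.Topology.FourManifolds.Trisection.spineHandlebody S 2) c' → 1 ≤ k 0 := by
  intro X _ _ _ _ _ g k S hS c' hc hns hd1 hd2
  refine one_le_kZero_of_doublyCompressing_nonseparating hS hc (fun q => ?_) hns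
  fin_cases q
  · exact hd1
  · exact hd2

end Summit.SmoothPoincare4.SmoothPoincare4.Theorems.WeakReductionReduces.LoopDichotomy

end
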